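import Literature.Probability.Percolation.SiteEnhancedCluster
import Literature.Probability.Percolation.EnhancedClusterModification
import HarnessLib

/-!
# The local modification lemma (Martineau–Severo 2019, Lemma 6.1) for the enhanced SITE cluster

Second file of the inline proof of the site-percolation version of Martineau–Severo's Corollary 2.2
(`MartineauSevero2019_cor22_site`); site twin of the tree's `EnhancedClusterModification.lean`.
Martineau–Severo (Ann. Probab. 47 (2019), §6; site adaptation announced in §2 and at the end of §6):

> **Lemma 6.1.** There are constants `R` and `L₀` such that the following holds. If `L ≥ L₀` and a
> site `y` is `p`-pivotal for `𝓔_L` in a configuration `(ω,α)`, then there exist a configuration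
> `(ω',α')` differing from `(ω,α)` only inside `B_R(y)` and a vertex `z` in `B_R(y)` such that `z` is
> `s`-pivotal for `𝓔_L` in `(ω',α')`.

We prove it (`exists_local_site_modification`) for the cluster `enhSiteCluster` / event `enhSiteEvent` of
`SiteEnhancedCluster.lean` on a connected locally finite graph, with `L₀ = r + 1` and the window
`siteModWindow` (sites within `2r+2`, marks within `3r+4` of `y`; `z` within `3r+3`). The proof follows the
printed (bond) one, with `ω⁺ = ω ∪ {y}`, `ω⁻ = ω ∖ {y}`:

* *removing marks* (`exists_pivotal_of_remove`, from the bond file): delete the marks near `y` one at a time;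
  if `𝓔_L` is lost on the way, the last deleted mark is `s`-pivotal. Otherwise `α' = α ∖ B_{3r+3}(y)` has no
  mark near `y` and `y` is still pivotal.
* *a neighbour `x` of `y` lies in `𝒞⁻ = 𝒞_o(ω⁻, α')`* (`enhSiteCluster_insert_subset`): otherwise `𝒞⁻` is closed
  under the rules of `(ω⁺, α')` (no mark of `α'` sees `y` in its `r`-ball), contradicting pivotality.
* *choice of `z`* on a geodesic from `o` to `x`, `d(z,x) ≤ r`, `B_r(z) ⊆ B_{L-1}(o)`; then `y ∈ B_{r+1}(z)`.
* *closing `B_{r+1}(z)` and opening `B_r(z)`*: with `ω̃ = ω⁻ ∖ B_{r+1}(z)`, the first entrance of `𝒞⁻` (which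
  contains `x ∈ B_r(z)`) into `B_{r+1}(z)` (`site_first_entrance`) is either a vertex `u ∈ S_{r+1}(z) ∩ 𝒞_o(ω̃,α')`,
  or an `ω⁻`-open site `w ∈ S_{r+1}(z)` adjacent to `𝒞_o(ω̃,α')` (the new, site-specific case), or `o ∈ B_r(z)`;
  accordingly `ω' = ω̃ ∪ C ∪ B_r(z)` with the connector `C = ∅`, `{w}`, `∅`. Then
  `𝒞_o(ω',α') ⊆ 𝒞_o(ω̃ ∪ C, α') ∪ B_r(z) ⊆ 𝒞⁻ ∪ B_r(z)` misses distance `L` (`enhSiteCluster_union_ball_subset`),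
  while with the extra mark at `z` the bonus fires (`z ∈ 𝒞_o(ω', ·)` through the connector and the open ball)
  and `𝒞_o(ω⁺,α') ⊆ 𝒞_o(ω', α' ∪ {z})` reaches it (`enhSiteCluster_subset_of_ball_subset`, using `y ∈ B_{r+1}(z)`):
  `z` is `s`-pivotal in `(ω', α')`.

## References

* S. Martineau, F. Severo, Ann. Probab. 47 (2019), §6, Lemma 6.1 and its proof; §2 (Convention) and the
  last sentence of §6 ("the proof above can be adapted to site percolation") [MartineauSevero2019].
* M. Aizenman, G. Grimmett, J. Stat. Phys. 63 (1991) 817–835, Lemma 2 [AizenmanGrimmett1991].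
-/

namespace Literature.Probability.Percolation

open Literature.Barriers.CriticalPhenomena

variable {W : Type*}

/-! ### Closure tools for the site cluster -/

section Closure

variable {H : SimpleGraph W} {r : ℕ}

/-- **Minimality**: `𝒞_A(ω,α)` is contained in every set containing `A` and closed under the two rules
(applied at points of the cluster). [cite: MartineauSevero2019, §4 (𝒞_o = ⋃ C_n)] -/
theorem enhSiteCluster_subset_of_closed {A : Set W} {ω : Set W} {α : Set W} (T : Set W) (hA : A ⊆ T)
    (hsite : ∀ u v, u ∈ enhSiteCluster H r A ω α → u ∈ T → H.Adj u v → v ∈ ω → v ∈ T)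
    (hbonus : ∀ u v, u ∈ enhSiteCluster H r A ω α → u ∈ T → u ∈ α → graphBall H u r ⊆ ω →
      H.dist u v = r + 1 → v ∈ T) :
    enhSiteCluster H r A ω α ⊆ T := fun _ hv =>
  enhSiteCluster_induction (P := fun v => v ∈ T) (fun _ hv => hA hv) hsite hbonus hv

/-- The vertices of a geodesic from `z` stay in the ball of its endpoint: if `dist(z,u) ≤ n` then there is a
walk from `u` to `z` all of whose vertices lie in `B_n(z)`. [folklore] -/
private theorem exists_walk_support_subset_graphBall {z u : W} {n : ℕ} (h : u ∈ graphBall H z n) :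
    ∃ w : H.Walk u z, ∀ v ∈ w.support, v ∈ graphBall H z n := by
  obtain ⟨w, hw⟩ := h
  refine ⟨w.reverse, fun v hv => ?_⟩
  rw [SimpleGraph.Walk.support_reverse, List.mem_reverse] at hv
  obtain ⟨q, q', hqq'⟩ := SimpleGraph.Walk.mem_support_iff_exists_append.1 hv
  refine ⟨q, ?_⟩
  have : q.length + q'.length = w.length := by rw [hqq', SimpleGraph.Walk.length_append]
  omega

/-- **Walking inwards** (site version): if `u ∈ 𝒞`, `u ∈ B_n(z)` and all sites of `B_n(z)` are open then
`z ∈ 𝒞` (follow a geodesic from `u` to `z`, which stays inside the open ball).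
[cite: MartineauSevero2019, §6 ("B_r(z) is p-open")] -/
theorem mem_enhSiteCluster_of_mem_graphBall {A : Set W} {ω : Set W} {α : Set W} {u z : W}
    {n : ℕ} (hu : u ∈ enhSiteCluster H r A ω α) (huz : u ∈ graphBall H z n) (hb : graphBall H z n ⊆ ω) :
    z ∈ enhSiteCluster H r A ω α := by
  obtain ⟨w, hw⟩ := exists_walk_support_subset_graphBall huz
  suffices h : ∀ (a b : W) (w : H.Walk a b), a ∈ enhSiteCluster H r A ω α →
      (∀ v ∈ w.support, v ∈ graphBall H z n) → b ∈ enhSiteCluster H r A ω α from h u z w hu hw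
  intro a b w
  induction w with
  | nil => intro ha _; exact ha
  | @cons a c b hac w' ih =>
    intro ha hsupp
    have hc : c ∈ graphBall H z n := hsupp c (by simp)
    exact ih (mem_enhSiteCluster_of_adj ha hac (hb hc)) fun v hv => hsupp v (by simp [hv])

/-- **The pivotal site is adjacent to the smaller cluster.** If every cluster neighbour `u` of `y` in
`𝒞⁻ = 𝒞_A(ω ∖ {y}, α)` forces `y ∈ 𝒞⁻`, and no mark of `α` has `y` in its `r`-ball, then
`𝒞_A(ω ∪ {y}, α) ⊆ 𝒞⁻` (the state of `y` is never used).
[cite: MartineauSevero2019, §6 (proof of Lemma 6.1, "e is p-pivotal"; site adaptation)] -/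
theorem enhSiteCluster_insert_subset {A : Set W} {ω : Set W} {α : Set W} {y : W}
    (hy : ∀ u, u ∈ enhSiteCluster H r A (ω \ {y}) α → H.Adj u y → y ∈ enhSiteCluster H r A (ω \ {y}) α)
    (hα : ∀ u ∈ α, y ∉ graphBall H u r) :
    enhSiteCluster H r A (insert y ω) α ⊆ enhSiteCluster H r A (ω \ {y}) α := by
  refine enhSiteCluster_subset_of_closed _ (subset_enhSiteCluster _ _ _ _ _) ?_ ?_
  · intro u v _ hu hadj hv
    rcases Set.mem_insert_iff.1 hv with rfl | hv
    · exact hy u hu hadj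
    · by_cases hvy : v = y
      · subst hvy; exact hy u hu hadj
      · exact mem_enhSiteCluster_of_adj hu hadj ⟨hv, hvy⟩
  · intro u v _ hu hαu hb hd
    refine mem_enhSiteCluster_of_bonus hu hαu (fun w hw => ?_) hd
    rcases Set.mem_insert_iff.1 (hb hw) with rfl | hw'
    · exact absurd hw (hα u hαu)
    · exact ⟨hw', fun hwy => hα u hαu (by rw [Set.mem_singleton_iff] at hwy; exact hwy ▸ hw)⟩

/-- **First entrance into `B_{r+1}(z)`** (site version). Let `ω̃ = ω ∖ B_{r+1}(z)` and assume no mark of `α`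
lies in `B_{2r+1}(z)`. Every vertex of `𝒞_o(ω, α)` either lies in `𝒞_o(ω̃, α)` outside `B_r(z)`, or some
`u ∈ 𝒞_o(ω̃, α)` has `dist(z,u) = r+1`, or some open site `w` with `dist(z,w) = r+1` has a neighbour in
`𝒞_o(ω̃, α)`, or `o ∈ B_r(z)`.
[cite: MartineauSevero2019, §6 (proof of Lemma 6.1, Case a: the vertex u ∈ S_{r+1}(z) ∩ 𝒞_o(ω̃, α'))] -/
theorem site_first_entrance (hH : H.Connected) {o z : W} {ω : Set W} {α : Set W}
    (hα : ∀ u ∈ α, u ∉ graphBall H z (2 * r + 1)) {v : W} (hv : v ∈ enhSiteCluster H r {o} ω α) :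
    (v ∈ enhSiteCluster H r {o} (ω \ graphBall H z (r + 1)) α ∧ v ∉ graphBall H z r) ∨
      (∃ u ∈ enhSiteCluster H r {o} (ω \ graphBall H z (r + 1)) α, H.dist z u = r + 1) ∨
      (∃ w ∈ ω, H.dist z w = r + 1 ∧ ∃ u ∈ enhSiteCluster H r {o} (ω \ graphBall H z (r + 1)) α, H.Adj u w) ∨
      o ∈ graphBall H z r := by
  set ω' := ω \ graphBall H z (r + 1) with hω'
  refine enhSiteCluster_induction (P := fun v =>
    (v ∈ enhSiteCluster H r {o} ω' α ∧ v ∉ graphBall H z r) ∨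
      (∃ u ∈ enhSiteCluster H r {o} ω' α, H.dist z u = r + 1) ∨
      (∃ w ∈ ω, H.dist z w = r + 1 ∧ ∃ u ∈ enhSiteCluster H r {o} ω' α, H.Adj u w) ∨
      o ∈ graphBall H z r) ?_ ?_ ?_ hv
  · intro w hw
    rw [Set.mem_singleton_iff] at hw
    subst hw
    by_cases ho : w ∈ graphBall H z r
    · exact Or.inr (Or.inr (Or.inr ho))
    · exact Or.inl ⟨subset_enhSiteCluster _ _ _ _ _ rfl, ho⟩
  · rintro u w - (⟨hu, hur⟩ | hrest) hadj hw
    · by_cases hwB : w ∈ graphBall H z (r + 1)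
      · by_cases huB : u ∈ graphBall H z (r + 1)
        · -- `u ∈ B_{r+1}(z) ∖ B_r(z)`: first entrance at `u`
          exact Or.inr (Or.inl ⟨u, hu, dist_eq_of_mem_graphBall_of_not_mem hH huB hur⟩)
        · -- `u ∉ B_{r+1}(z)`, `w ∈ B_{r+1}(z)`: the open sphere site `w` is entered from outside
          have hwr : w ∉ graphBall H z r := fun hwr =>
            huB (mem_graphBall_trans hwr (mem_graphBall_one_of_adj' hadj.symm))
          exact Or.inr (Or.inr (Or.inl ⟨w, hw, dist_eq_of_mem_graphBall_of_not_mem hH hwB hwr, u, hu, hadj⟩))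
      · have hw' : w ∈ enhSiteCluster H r {o} ω' α := mem_enhSiteCluster_of_adj hu hadj ⟨hw, hwB⟩
        exact Or.inl ⟨hw', fun hwr => hwB (graphBall_mono H z (Nat.le_succ r) hwr)⟩
    · exact Or.inr hrest
  · rintro u w - (⟨hu, -⟩ | hrest) hαu hb hd
    · have hfar : u ∉ graphBall H z (2 * r + 1) := hα u hαu
      have hb' : graphBall H u r ⊆ ω' := by
        intro t ht
        refine ⟨hb ht, fun htz => hfar ?_⟩
        have := mem_graphBall_trans htz (mem_graphBall_symm ht)
        have h2 : r + 1 + r = 2 * r + 1 := by ring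
        rw [h2] at this
        exact this
      have hw : w ∈ enhSiteCluster H r {o} ω' α := mem_enhSiteCluster_of_bonus hu hαu hb' hd
      refine Or.inl ⟨hw, fun hwr => hfar ?_⟩
      have h1 : w ∈ graphBall H u (r + 1) := mem_graphBall_of_dist_le hH hd.le
      have := mem_graphBall_trans hwr (mem_graphBall_symm h1)
      have h2 : r + (r + 1) = 2 * r + 1 := by ring
      rw [h2] at this
      exact this
    · exact Or.inr hrest

/-- **Upper bound for the modified cluster** (site version). If every `ω₀`-open site of `B_{r+1}(z)` already
lies in `𝒞_o(ω₀, α)` and `α` has no mark in `B_{2r+1}(z)`, then `𝒞_o(ω₀ ∪ B_r(z), α) ⊆ 𝒞_o(ω₀, α) ∪ B_r(z)`.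
[cite: MartineauSevero2019, §6 (proof of Lemma 6.1: "𝒞_o(ω', α') = 𝒞_o(ω̃, α') ∪ B_r(z)")] -/
theorem enhSiteCluster_union_ball_subset {o z : W} {ω₀ : Set W} {α : Set W}
    (hω₀ : ∀ w ∈ ω₀, w ∈ graphBall H z (r + 1) → w ∈ enhSiteCluster H r {o} ω₀ α)
    (hα : ∀ u ∈ α, u ∉ graphBall H z (2 * r + 1)) :
    enhSiteCluster H r {o} (ω₀ ∪ graphBall H z r) α ⊆ enhSiteCluster H r {o} ω₀ α ∪ graphBall H z r := by
  refine enhSiteCluster_subset_of_closed _ ?_ ?_ ?_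
  · exact (subset_enhSiteCluster _ _ _ _ _).trans Set.subset_union_left
  · rintro u v - hu hadj (hv | hv)
    · rcases hu with hu | hu
      · exact Or.inl (mem_enhSiteCluster_of_adj hu hadj hv)
      · -- an `ω₀`-open neighbour of a ball point lies in `B_{r+1}(z)`, hence in the `ω₀`-cluster
        exact Or.inl (hω₀ v hv (mem_graphBall_trans hu (mem_graphBall_one_of_adj' hadj)))
    · exact Or.inr hv
  · rintro u v - hu hαu hb hd
    have hfar := hα u hαu
    have hu' : u ∈ enhSiteCluster H r {o} ω₀ α := by
      rcases hu with hu | hu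
      · exact hu
      · exact absurd (graphBall_mono H z (by omega) hu) hfar
    refine Or.inl (mem_enhSiteCluster_of_bonus hu' hαu (fun t ht => ?_) hd)
    rcases hb ht with ht' | ht'
    · exact ht'
    · exfalso
      refine hfar ?_
      have := mem_graphBall_trans ht' (mem_graphBall_symm ht)
      exact graphBall_mono H z (by omega) this

/-- **Lower bound with the bonus at `z`** (site version). If `B_{r+1}(z) ⊆ 𝒞' := 𝒞_o(ω', α'')`,
`ω ⊆ ω' ∪ B_{r+1}(z)`, `α ⊆ α''` and `α` has no mark in `B_{2r+1}(z)`, then `𝒞_o(ω, α) ⊆ 𝒞'`.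
[cite: MartineauSevero2019, §6 (proof of Lemma 6.1: "𝒞_o(ω,α') ⊆ 𝒞_{B_{r+1}(z) ∪ {o}}(ω', α' ∪ {z})")] -/
theorem enhSiteCluster_subset_of_ball_subset {o z : W} {ω ω' : Set W} {α α'' : Set W}
    (hball : graphBall H z (r + 1) ⊆ enhSiteCluster H r {o} ω' α'')
    (hω : ω ⊆ ω' ∪ graphBall H z (r + 1)) (hαsub : α ⊆ α'')
    (hα : ∀ u ∈ α, u ∉ graphBall H z (2 * r + 1)) :
    enhSiteCluster H r {o} ω α ⊆ enhSiteCluster H r {o} ω' α'' := by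
  refine enhSiteCluster_subset_of_closed _ (subset_enhSiteCluster _ _ _ _ _) ?_ ?_
  · rintro u v - hu hadj hv
    rcases hω hv with hv' | hv'
    · exact mem_enhSiteCluster_of_adj hu hadj hv'
    · exact hball hv'
  · rintro u v - hu hαu hb hd
    have hfar := hα u hαu
    refine mem_enhSiteCluster_of_bonus hu (hαsub hαu) (fun t ht => ?_) hd
    rcases hω (hb ht) with ht' | ht'
    · exact ht'
    · exfalso
      refine hfar ?_
      have := mem_graphBall_trans ht' (mem_graphBall_symm ht)
      have h2 : r + 1 + r = 2 * r + 1 := by ring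
      rw [h2] at this
      exact this

end Closure

/-! ### Coordinates -/

section Coord

/-- `enhSiteOmega` of `inl '' ω ∪ inr '' α`. [cite: MartineauSevero2019, §4 ((ω, α))] -/
@[simp] theorem enhSiteOmega_image_union (ω α : Set W) :
    enhSiteOmega (Sum.inl '' ω ∪ Sum.inr '' α) = ω := by
  ext v; simp [enhSiteOmega]

/-- `enhSiteAlpha` of `inl '' ω ∪ inr '' α`. [cite: MartineauSevero2019, §4 ((ω, α))] -/
@[simp] theorem enhSiteAlpha_image_union (ω α : Set W) :
    enhSiteAlpha (Sum.inl '' ω ∪ Sum.inr '' α) = α := by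
  ext v; simp [enhSiteAlpha]

/-- `enhSiteOmega` of `insert (inl y) ξ`. [cite: MartineauSevero2019, §4 ((ω, α))] -/
@[simp] theorem enhSiteOmega_insert_inl (y : W) (ξ : Set (W ⊕ W)) :
    enhSiteOmega (insert (Sum.inl y) ξ) = insert y (enhSiteOmega ξ) := by
  ext v; simp [enhSiteOmega]

/-- `enhSiteAlpha` of `insert (inl y) ξ`. [cite: MartineauSevero2019, §4 ((ω, α))] -/
@[simp] theorem enhSiteAlpha_insert_inl (y : W) (ξ : Set (W ⊕ W)) :
    enhSiteAlpha (insert (Sum.inl y) ξ) = enhSiteAlpha ξ := by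
  ext v; simp [enhSiteAlpha]

/-- `enhSiteOmega` of `ξ ∖ {inl y}`. [cite: MartineauSevero2019, §4 ((ω, α))] -/
@[simp] theorem enhSiteOmega_diff_inl (y : W) (ξ : Set (W ⊕ W)) :
    enhSiteOmega (ξ \ {Sum.inl y}) = enhSiteOmega ξ \ {y} := by
  ext v; simp [enhSiteOmega]

/-- `enhSiteAlpha` of `ξ ∖ {inl y}`. [cite: MartineauSevero2019, §4 ((ω, α))] -/
@[simp] theorem enhSiteAlpha_diff_inl (y : W) (ξ : Set (W ⊕ W)) :
    enhSiteAlpha (ξ \ {Sum.inl y}) = enhSiteAlpha ξ := by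
  ext v; simp [enhSiteAlpha]

/-- `enhSiteOmega` of `insert (inr z) ξ`. [cite: MartineauSevero2019, §4 ((ω, α))] -/
@[simp] theorem enhSiteOmega_insert_inr (z : W) (ξ : Set (W ⊕ W)) :
    enhSiteOmega (insert (Sum.inr z) ξ) = enhSiteOmega ξ := by
  ext v; simp [enhSiteOmega]

/-- `enhSiteAlpha` of `insert (inr z) ξ`. [cite: MartineauSevero2019, §4 ((ω, α))] -/
@[simp] theorem enhSiteAlpha_insert_inr (z : W) (ξ : Set (W ⊕ W)) :
    enhSiteAlpha (insert (Sum.inr z) ξ) = insert z (enhSiteAlpha ξ) := by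
  ext v; simp [enhSiteAlpha]

/-- `enhSiteOmega` of `ξ ∖ {inr z}`. [cite: MartineauSevero2019, §4 ((ω, α))] -/
@[simp] theorem enhSiteOmega_diff_inr (z : W) (ξ : Set (W ⊕ W)) :
    enhSiteOmega (ξ \ {Sum.inr z}) = enhSiteOmega ξ := by
  ext v; simp [enhSiteOmega]

/-- `enhSiteAlpha` of `ξ ∖ {inr z}`. [cite: MartineauSevero2019, §4 ((ω, α))] -/
@[simp] theorem enhSiteAlpha_diff_inr (z : W) (ξ : Set (W ⊕ W)) :
    enhSiteAlpha (ξ \ {Sum.inr z}) = enhSiteAlpha ξ \ {z} := by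
  ext v; simp [enhSiteAlpha]

/-- For an increasing event, `i` is pivotal iff the event holds with `i` and fails without it (private
copy of the tree's `isPivotal_iff_of_isUpperSet`, to keep the imports light). [folklore] -/
private theorem isPivotal_iff_of_isUpperSet' {ι : Type*} {A : Set (Set ι)} (hA : IsUpperSet A) (e : ι)
    (ω : Set ι) : IsPivotal A e ω ↔ insert e ω ∈ A ∧ ω \ {e} ∉ A := by
  unfold IsPivotal
  have hsub : ω \ {e} ⊆ insert e ω := Set.sdiff_subset.trans (Set.subset_insert e ω)
  constructor
  · rintro (⟨h1, h2⟩ | ⟨h1, h2⟩)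
    · exact ⟨h1, h2⟩
    · exact absurd (hA hsub h1) h2
  · rintro ⟨h1, h2⟩; exact Or.inl ⟨h1, h2⟩

/-- Membership in `𝓔_L` through `(ω, α)` (site version). [cite: MartineauSevero2019, §6 (𝓔_L)] -/
theorem mem_enhSiteEvent_iff {H : SimpleGraph W} {r : ℕ} {o : W} {L : ℕ} {ξ : Set (W ⊕ W)} :
    ξ ∈ enhSiteEvent H r o L ↔
      ∃ v, v ∈ enhSiteCluster H r {o} (enhSiteOmega ξ) (enhSiteAlpha ξ) ∧ L ≤ H.dist o v :=
  Iff.rfl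

end Coord

/-! ### The local modification -/

section Modification

variable {H : SimpleGraph W} {r : ℕ}

/-- The **window of the modification** around the site `y`: site coordinates within `2r+2` and mark
coordinates within `3r+4` of `y` (Martineau–Severo's `B_R(e)` up to the bookkeeping of our radii).
[cite: MartineauSevero2019, Lemma 6.1 (B_R(e))] -/
def siteModWindow (H : SimpleGraph W) (r : ℕ) (y : W) : Set (W ⊕ W) :=
  Sum.inl '' graphBall H y (2 * r + 2) ∪ Sum.inr '' graphBall H y (3 * r + 4)

/-- A site coordinate near `y` lies in the window. [cite: MartineauSevero2019, Lemma 6.1 (B_R(e))] -/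
theorem inl_mem_siteModWindow {y v : W} (hv : v ∈ graphBall H y (2 * r + 2)) :
    (Sum.inl v : W ⊕ W) ∈ siteModWindow H r y :=
  Or.inl ⟨v, hv, rfl⟩

/-- A mark coordinate near `y` lies in the window. [cite: MartineauSevero2019, Lemma 6.1 (B_R(e))] -/
theorem inr_mem_siteModWindow {y v : W} (hv : v ∈ graphBall H y (3 * r + 4)) :
    (Sum.inr v : W ⊕ W) ∈ siteModWindow H r y :=
  Or.inr ⟨v, hv, rfl⟩

/-- The probability-free content of **Lemma 6.1 for sites**, in the configuration `(ω, α)` after the marks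
near `y` have been removed: given the pivotal site `y` — `𝒞_o(ω ∪ {y}, α)` reaches distance `L`,
`𝒞_o(ω ∖ {y}, α)` does not — with a neighbour `x ∈ 𝒞_o(ω ∖ {y}, α)`, no mark of `α` within `3r+2` of `x`,
and `L ≥ r+1`, there are `z ∈ B_r(x)` and `ω'` agreeing with `ω` off `B_{r+1}(z)` such that `z ∉ α`,
`(ω', α) ∉ 𝓔_L` and `(ω', α ∪ {z}) ∈ 𝓔_L`. [cite: MartineauSevero2019, Lemma 6.1 (proof, Cases a and b; site adaptation)] -/
theorem exists_center_site_modification [H.LocallyFinite] (hH : H.Connected) {o : W} {L : ℕ}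
    (hL : r + 1 ≤ L) {ω : Set W} {α : Set W} {x y : W} (hxy : H.Adj x y)
    (hfar : ∃ v, v ∈ enhSiteCluster H r {o} (insert y ω) α ∧ L ≤ H.dist o v)
    (hnot : ∀ v, v ∈ enhSiteCluster H r {o} (ω \ {y}) α → H.dist o v < L)
    (hx : x ∈ enhSiteCluster H r {o} (ω \ {y}) α)
    (hα : ∀ u ∈ α, u ∉ graphBall H x (3 * r + 2)) :
    ∃ z ∈ graphBall H x r, ∃ ω' : Set W,
      (∀ v, v ∉ graphBall H z (r + 1) → (v ∈ ω' ↔ v ∈ ω)) ∧ z ∉ α ∧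
      (∀ v, v ∈ enhSiteCluster H r {o} ω' α → H.dist o v < L) ∧
      (∃ v, v ∈ enhSiteCluster H r {o} ω' (insert z α) ∧ L ≤ H.dist o v) := by
  set ωm : Set W := ω \ {y} with hωm
  -- distances of `x`
  have hxL : H.dist o x < L := hnot x hx
  -- choice of `z` on a geodesic from `o` to `x`
  obtain ⟨z, hz1, hz2⟩ : ∃ z, H.dist o z ≤ L - 1 - r ∧ H.dist z x ≤ r := by
    obtain ⟨z, h1, h2⟩ := exists_dist_eq_dist_sub hH o x (k := min (H.dist o x) (L - 1 - r)) (min_le_left _ _)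
    refine ⟨z, ?_, ?_⟩
    · rw [h1]; exact min_le_right _ _
    · rw [h2]; omega
  have hxz : x ∈ graphBall H z r := mem_graphBall_of_dist_le hH hz2
  have hzx : z ∈ graphBall H x r := mem_graphBall_symm hxz
  have hyz : y ∈ graphBall H z (r + 1) := mem_graphBall_trans hxz (mem_graphBall_one_of_adj' hxy)
  -- no marks near `z`
  have hαz : ∀ u ∈ α, u ∉ graphBall H z (2 * r + 1) := fun u hu huz => hα u hu (by
    have := mem_graphBall_trans hzx huz
    have h : r + (2 * r + 1) ≤ 3 * r + 2 := by omega
    exact graphBall_mono H x h this)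
  have hzα : z ∉ α := fun hz => hαz z hz (mem_graphBall_self H z _)
  -- the closed-ball deletion `ω̃ ⊆ ω⁻`
  set ωt : Set W := ωm \ graphBall H z (r + 1) with hωt
  have hωt_sub : ωt ⊆ ωm := Set.sdiff_subset
  have hωt_far : ∀ v, v ∈ enhSiteCluster H r {o} ωt α → H.dist o v < L := fun v hv =>
    hnot v (enhSiteCluster_mono H r subset_rfl hωt_sub subset_rfl hv)
  -- points of `B_r(z)` are at distance `< L`
  have hball_far : ∀ v ∈ graphBall H z r, H.dist o v < L := fun v hv => by
    have h1 : H.dist o v ≤ H.dist o z + H.dist z v := hH.dist_triangle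
    have h2 := dist_le_of_mem_graphBall hv
    omega
  -- first entrance of `𝒞⁻` into `B_{r+1}(z)`, and the connector `C`
  have hfe := site_first_entrance (r := r) hH (z := z) (ω := ωm) hαz hx
  obtain ⟨C, hC1, hC2, hC3⟩ : ∃ C : Set W, C ⊆ ωm ∩ graphBall H z (r + 1) ∧
      (∀ w ∈ ωt ∪ C, w ∈ graphBall H z (r + 1) → w ∈ enhSiteCluster H r {o} (ωt ∪ C) α) ∧
      ∀ ω' : Set W, ωt ∪ C ⊆ ω' → graphBall H z r ⊆ ω' → ∀ α'' : Set W, α ⊆ α'' →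
        z ∈ enhSiteCluster H r {o} ω' α'' := by
    rcases hfe with ⟨-, hxr⟩ | ⟨u, hu, hdu⟩ | ⟨w, hw, hdw, u, hu, huw⟩ | ho
    · exact absurd hxz hxr
    · -- Case a: a vertex `u ∈ S_{r+1}(z) ∩ 𝒞_o(ω̃, α)`; no connector
      obtain ⟨um, hadj, hum⟩ := exists_adj_mem_graphBall_of_dist_eq hH hdu
      refine ⟨∅, by simp, ?_, ?_⟩
      · rintro w (hw | hw) hwB
        · exact absurd hwB hw.2
        · exact absurd hw (Set.notMem_empty w)
      · intro ω' hωt' hB α'' hα''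
        have hu' : u ∈ enhSiteCluster H r {o} ω' α'' :=
          enhSiteCluster_mono H r subset_rfl (Set.subset_union_left.trans hωt') hα'' hu
        have hum' : um ∈ enhSiteCluster H r {o} ω' α'' := mem_enhSiteCluster_of_adj hu' hadj.symm (hB hum)
        exact mem_enhSiteCluster_of_mem_graphBall hum' hum hB
    · -- Case a': an open sphere site `w` entered from outside; connector `{w}`
      have hwB : w ∈ graphBall H z (r + 1) := mem_graphBall_of_dist_le hH hdw.le
      obtain ⟨wm, hadj, hwm⟩ := exists_adj_mem_graphBall_of_dist_eq hH hdw
      have hwC : w ∈ enhSiteCluster H r {o} (ωt ∪ {w}) α :=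
        mem_enhSiteCluster_of_adj (enhSiteCluster_mono H r subset_rfl Set.subset_union_left subset_rfl hu)
          huw (Or.inr rfl)
      refine ⟨{w}, ?_, ?_, ?_⟩
      · intro t ht
        rw [Set.mem_singleton_iff] at ht
        subst ht
        exact ⟨hw, hwB⟩
      · rintro t (ht | ht) htB
        · exact absurd htB ht.2
        · rw [Set.mem_singleton_iff] at ht
          subst ht
          exact hwC
      · intro ω' hωt' hB α'' hα''
        have hu' : u ∈ enhSiteCluster H r {o} ω' α'' :=
          enhSiteCluster_mono H r subset_rfl (Set.subset_union_left.trans hωt') hα'' hu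
        have hw' : w ∈ enhSiteCluster H r {o} ω' α'' :=
          mem_enhSiteCluster_of_adj hu' huw (hωt' (Or.inr rfl))
        have hwm' : wm ∈ enhSiteCluster H r {o} ω' α'' := mem_enhSiteCluster_of_adj hw' hadj.symm (hB hwm)
        exact mem_enhSiteCluster_of_mem_graphBall hwm' hwm hB
    · -- Case b: `o ∈ B_r(z)`, no connector
      refine ⟨∅, by simp, ?_, ?_⟩
      · rintro w (hw | hw) hwB
        · exact absurd hwB hw.2
        · exact absurd hw (Set.notMem_empty w)
      · intro ω' _ hB α'' _
        exact mem_enhSiteCluster_of_mem_graphBall (subset_enhSiteCluster _ _ _ _ _ rfl) ho hB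
  set ω' : Set W := (ωt ∪ C) ∪ graphBall H z r with hω'
  refine ⟨z, hzx, ω', ?_, hzα, ?_, ?_⟩
  · -- agreement off `B_{r+1}(z)`
    intro v hv
    have hvy : v ≠ y := fun h => hv (h ▸ hyz)
    simp only [hω', hωt, hωm, Set.mem_union, Set.mem_sdiff, Set.mem_singleton_iff]
    constructor
    · rintro ((⟨⟨h, -⟩, -⟩ | h) | h)
      · exact h
      · exact (hC1 h).1.1
      · exact absurd (graphBall_mono H z (Nat.le_succ r) h) hv
    · intro h; exact Or.inl (Or.inl ⟨⟨h, hvy⟩, hv⟩)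
  · -- (i) `(ω', α) ∉ 𝓔_L`
    intro v hv
    have hsub := enhSiteCluster_union_ball_subset (r := r) (o := o) hC2 hαz hv
    rcases hsub with h | h
    · refine hnot v (enhSiteCluster_mono H r subset_rfl ?_ subset_rfl h)
      exact Set.union_subset hωt_sub fun t ht => (hC1 ht).1
    · exact hball_far v h
  · -- (ii) `(ω', α ∪ {z}) ∈ 𝓔_L`
    have hB : graphBall H z r ⊆ ω' := fun t ht => Or.inr ht
    have hz' : z ∈ enhSiteCluster H r {o} ω' (insert z α) :=
      hC3 ω' Set.subset_union_left hB _ (Set.subset_insert _ _)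
    have hball : graphBall H z (r + 1) ⊆ enhSiteCluster H r {o} ω' (insert z α) := by
      intro v hv
      by_cases hvr : v ∈ graphBall H z r
      · exact graphBall_subset_enhSiteCluster hz' hB hvr
      · exact mem_enhSiteCluster_of_bonus hz' (Set.mem_insert _ _) hB
          (dist_eq_of_mem_graphBall_of_not_mem hH hv hvr)
    have hωsub : insert y ω ⊆ ω' ∪ graphBall H z (r + 1) := by
      intro t ht
      by_cases htz : t ∈ graphBall H z (r + 1)
      · exact Or.inr htz
      · rcases Set.mem_insert_iff.1 ht with rfl | ht
        · exact absurd hyz htz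
        · have hty : t ≠ y := fun h => htz (h ▸ hyz)
          exact Or.inl (Or.inl (Or.inl ⟨⟨ht, hty⟩, htz⟩))
    obtain ⟨v, hv, hLv⟩ := hfar
    exact ⟨v, enhSiteCluster_subset_of_ball_subset hball hωsub (Set.subset_insert _ _) hαz hv, hLv⟩

/-- **Martineau–Severo 2019, Lemma 6.1 (local modification) for the enhanced SITE cluster on a connected
locally finite graph, with `L₀ = r + 1`.** If `L ≥ r + 1` and the site `y` is `p`-pivotal for `𝓔_L` in
`ξ = (ω, α)`, there are a configuration `ξ'` agreeing with `ξ` off `siteModWindow H r y`, whose marks are marks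
of `ξ` (marks are only removed), and a vertex `z ∈ B_{3r+3}(y)` which is `s`-pivotal for `𝓔_L` in `ξ'`.
[cite: MartineauSevero2019, Lemma 6.1 (site adaptation, §2 Convention and end of §6)] -/
theorem exists_local_site_modification [H.LocallyFinite] (hH : H.Connected) {o : W} {L : ℕ}
    (hL : r + 1 ≤ L) (y : W) {ξ : Set (W ⊕ W)} (hpiv : IsPivotal (enhSiteEvent H r o L) (Sum.inl y) ξ) :
    ∃ ξ' : Set (W ⊕ W), ∃ z : W, (∀ i, i ∉ siteModWindow H r y → (i ∈ ξ' ↔ i ∈ ξ)) ∧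
      (∀ v : W, Sum.inr v ∈ ξ' → Sum.inr v ∈ ξ) ∧
      z ∈ graphBall H y (3 * r + 3) ∧ IsPivotal (enhSiteEvent H r o L) (Sum.inr z) ξ' := by
  classical
  -- unpack pivotality of `y`
  rw [isPivotal_iff_of_isUpperSet' (isUpperSet_enhSiteEvent H r o L)] at hpiv
  obtain ⟨hin, hout⟩ := hpiv
  rw [mem_enhSiteEvent_iff, enhSiteOmega_insert_inl, enhSiteAlpha_insert_inl] at hin
  rw [mem_enhSiteEvent_iff, enhSiteOmega_diff_inl, enhSiteAlpha_diff_inl] at hout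
  set ω := enhSiteOmega ξ with hωdef
  set α := enhSiteAlpha ξ with hαdef
  -- the marks to be removed
  set M : Finset W := ((graphBall_finite H y (3 * r + 3)).inter_of_right α).toFinset with hM
  have hMmem : ∀ v, v ∈ M ↔ v ∈ α ∧ v ∈ graphBall H y (3 * r + 3) := fun v => by
    rw [hM, Set.Finite.mem_toFinset]; rfl
  set P : Set W → Prop := fun β => ∃ v, v ∈ enhSiteCluster H r {o} (insert y ω) β ∧ L ≤ H.dist o v with hP
  have hPmono : ∀ a b : Set W, a ⊆ b → P a → P b := fun a b hab ⟨v, hv, hLv⟩ =>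
    ⟨v, enhSiteCluster_mono H r subset_rfl subset_rfl hab hv, hLv⟩
  have hP1 : P α := hin
  -- configuration with sites `ω'` and marks `β`
  set cfg : Set W → Set W → Set (W ⊕ W) := fun ω' β => Sum.inl '' ω' ∪ Sum.inr '' β with hcfg
  have hcfg_mem_inl : ∀ (ω' β : Set W) (v : W), (Sum.inl v : W ⊕ W) ∈ cfg ω' β ↔ v ∈ ω' :=
    fun ω' β v => by simp [hcfg]
  have hcfg_mem_inr : ∀ (ω' β : Set W) (v : W), (Sum.inr v : W ⊕ W) ∈ cfg ω' β ↔ v ∈ β :=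
    fun ω' β v => by simp [hcfg]
  have hξ_inl : ∀ v : W, (Sum.inl v : W ⊕ W) ∈ ξ ↔ v ∈ ω := fun v => Iff.rfl
  have hξ_inr : ∀ v : W, (Sum.inr v : W ⊕ W) ∈ ξ ↔ v ∈ α := fun v => Iff.rfl
  have hy0 : y ∈ graphBall H y (2 * r + 2) := mem_graphBall_self H y _
  by_cases hP2 : P (α \ ↑M)
  · -- Step 2: the geometric modification in `(ω, α')`, `α' = α ∖ M`
    set α' : Set W := α \ ↑M with hα'
    have hα'sub : α' ⊆ α := Set.sdiff_subset
    have hnot : ∀ v, v ∈ enhSiteCluster H r {o} (ω \ {y}) α' → H.dist o v < L := by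
      intro v hv
      by_contra hge
      exact hout ⟨v, enhSiteCluster_mono H r subset_rfl subset_rfl hα'sub hv, not_lt.1 hge⟩
    have hαy : ∀ u ∈ α', y ∉ graphBall H u r := by
      rintro u ⟨huα, huM⟩ hyu
      exact huM (Finset.mem_coe.2 ((hMmem u).2 ⟨huα, graphBall_mono H y (by omega) (mem_graphBall_symm hyu)⟩))
    -- a neighbour `x` of `y` lies in `𝒞⁻`
    obtain ⟨x, hx, hxy⟩ : ∃ x, x ∈ enhSiteCluster H r {o} (ω \ {y}) α' ∧ H.Adj x y := by
      by_contra hne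
      push Not at hne
      obtain ⟨v, hv, hLv⟩ := hP2
      have hsub := enhSiteCluster_insert_subset (H := H) (r := r) (A := {o}) (ω := ω) (α := α') (y := y)
        (fun u hu hadj => absurd hadj (hne u hu)) hαy
      exact absurd (hnot v (hsub hv)) (not_lt.2 hLv)
    have hx1 : x ∈ graphBall H y 1 := mem_graphBall_one_of_adj' hxy.symm
    have hαx : ∀ u ∈ α', u ∉ graphBall H x (3 * r + 2) := by
      rintro u ⟨huα, huM⟩ hux
      refine huM (Finset.mem_coe.2 ((hMmem u).2 ⟨huα, ?_⟩))
      have := mem_graphBall_trans hx1 hux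
      have h : 1 + (3 * r + 2) = 3 * r + 3 := by ring
      rw [h] at this
      exact this
    obtain ⟨z, hzx, ω', hagree, hzα, hfar1, hfar2⟩ :=
      exists_center_site_modification hH hL hxy hP2 hnot hx hαx
    refine ⟨cfg ω' α', z, ?_, ?_, ?_, ?_⟩
    · -- agreement off the window
      rintro (v | v) hi
      · rw [hcfg_mem_inl, hξ_inl]
        have hv : v ∉ graphBall H z (r + 1) := fun hv => hi (inl_mem_siteModWindow (by
          have := mem_graphBall_trans hx1 (mem_graphBall_trans hzx hv)
          exact graphBall_mono H y (by omega) this))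
        exact hagree v hv
      · rw [hcfg_mem_inr, hξ_inr, hα']
        simp only [Set.mem_sdiff, Finset.mem_coe, hMmem, not_and]
        constructor
        · exact fun h => h.1
        · intro hv
          refine ⟨hv, fun _ hv3 => hi (inr_mem_siteModWindow ?_)⟩
          exact graphBall_mono H y (by omega) hv3
    · -- marks are only removed
      intro v hv
      rw [hcfg_mem_inr] at hv
      exact (hξ_inr v).2 (hα'sub hv)
    · exact graphBall_mono H y (by omega) (mem_graphBall_trans hx1 hzx)
    · -- `z` is `s`-pivotal in `(ω', α')`
      rw [isPivotal_iff_of_isUpperSet' (isUpperSet_enhSiteEvent H r o L), mem_enhSiteEvent_iff,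
        mem_enhSiteEvent_iff, enhSiteOmega_insert_inr, enhSiteAlpha_insert_inr, enhSiteOmega_diff_inr,
        enhSiteAlpha_diff_inr]
      simp only [hcfg, enhSiteOmega_image_union, enhSiteAlpha_image_union]
      refine ⟨hfar2, ?_⟩
      rintro ⟨v, hv, hLv⟩
      have : α' \ {z} = α' := by
        ext u; simp only [Set.mem_sdiff, Set.mem_singleton_iff, and_iff_left_iff_imp]
        rintro hu rfl; exact hzα hu
      rw [this] at hv
      exact absurd (hfar1 v hv) (not_lt.2 hLv)
  · -- Step 1: a removed mark is pivotal (in `(ω ∪ {y}, ·)`)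
    obtain ⟨z, hzM, α'', h1, h2, h3, h4, h5⟩ := exists_pivotal_of_remove P hPmono α M hP1 hP2
    refine ⟨cfg (insert y ω) α'', z, ?_, ?_, ?_, ?_⟩
    · rintro (v | v) hi
      · rw [hcfg_mem_inl, hξ_inl, Set.mem_insert_iff]
        constructor
        · rintro (rfl | h)
          · exact absurd (inl_mem_siteModWindow hy0) hi
          · exact h
        · exact fun h => Or.inr h
      · rw [hcfg_mem_inr, hξ_inr]
        constructor
        · exact fun h => h2 h
        · intro hv
          refine h1 ⟨hv, fun hvM => hi (inr_mem_siteModWindow ?_)⟩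
          exact graphBall_mono H y (by omega) ((hMmem v).1 (Finset.mem_coe.1 hvM)).2
    · intro v hv
      rw [hcfg_mem_inr] at hv
      exact (hξ_inr v).2 (h2 hv)
    · exact ((hMmem z).1 hzM).2
    · rw [isPivotal_iff_of_isUpperSet' (isUpperSet_enhSiteEvent H r o L), mem_enhSiteEvent_iff,
        mem_enhSiteEvent_iff, enhSiteOmega_insert_inr, enhSiteAlpha_insert_inr, enhSiteOmega_diff_inr,
        enhSiteAlpha_diff_inr]
      simp only [hcfg, enhSiteOmega_image_union, enhSiteAlpha_image_union]
      refine ⟨h4, ?_⟩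
      have : α'' \ {z} = α'' := by
        ext u; simp only [Set.mem_sdiff, Set.mem_singleton_iff, and_iff_left_iff_imp]
        rintro hu rfl; exact h3 hu
      rw [this]
      exact h5

end Modification

end Literature.Probability.Percolation
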